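import Summits.CriticalPhenomena.PercolationContinuityZ3.Theses.PercGamblersRuin

/-!
# Assembly of route PercGamblersRuin (item stmt-CriticalPhenomena-7776)

The assembly item of route `route-CriticalPhenomena-PercGamblersRuin` is the implication
`VerticalGamblersRuin → BGNOffTheFloor → MinimalVoltage → PercolationContinuityZ3`.
The route file carries the sorry-free deciding theorem `closes` with exactly these three
hypotheses and conclusion `PercolationContinuityZ3` (θ(p_c) = 0 on ℤ³, by contradiction:
VGR gives plates `a < b`, a constant `c > 0` and `N₀`; BGN off the floor gives a large `n`
with `P_{p_c}(climb) < c`; the grounded minimal voltage `v` of `MinimalVoltage` then has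
`c ≤ ∫_{0↔∞} v(·,0) ≤ P_{p_c}(climb) < c`). The assembly is therefore that theorem, curried.
-/

namespace Summit.CriticalPhenomena.PercolationContinuityZ3.Theorems

open Summit.CriticalPhenomena.PercolationContinuityZ3.Theses.PercGamblersRuin

/-- **Assembly** of route PercGamblersRuin (item stmt-CriticalPhenomena-7776):
`VerticalGamblersRuin → BGNOffTheFloor → MinimalVoltage → PercolationContinuityZ3`,
discharged by the route's deciding theorem `closes`. -/
theorem percGamblersRuin_assembly_proof :
    Summit.CriticalPhenomena.PercolationContinuityZ3.Theses.PercGamblersRuin.Assembly := by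
  unfold Summit.CriticalPhenomena.PercolationContinuityZ3.Theses.PercGamblersRuin.Assembly
  intro hVGR hBGN hMV
  exact closes hVGR hBGN hMV

end Summit.CriticalPhenomena.PercolationContinuityZ3.Theorems
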